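import Mathlib
import HarnessLib
import Literature.Barriers.ValiantsHypothesis.FeketeSupportSplittingNeedsLegendre

/-!
# FeketeNoSparseSplitWithoutLegendre — MOVED (deprecated alias module)

Topic `Literature/Uncategorized`. Every declaration of this gate-parked module now lives,
byte-identical, in `Literature/Barriers/ValiantsHypothesis/FeketeSupportSplittingNeedsLegendre.lean`
(namespace `Literature.Barriers.ValiantsHypothesis`; librarian move 2026-08-16). This module keeps
the main constant as a deprecated reducible `abbrev` of the moved one and every other name as a
deprecated alias, so that importers keep compiling (deprecation warnings only); it can be deleted
once no module names `Literature.Uncategorized.FeketeNoSparseSplitWithoutLegendre`.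
-/

namespace Literature.Uncategorized

/-- DEPRECATED alias (librarian move 2026-08-16): this constant is, by definition, the moved
`Literature.Barriers.ValiantsHypothesis.FeketeNoSparseSplitWithoutLegendre`
(statement byte-identical there); kept as a reducible `abbrev` so that files naming the old
constant keep elaborating. [folklore] -/
@[deprecated Literature.Barriers.ValiantsHypothesis.FeketeNoSparseSplitWithoutLegendre
  (since := "2026-08-16")]
abbrev FeketeNoSparseSplitWithoutLegendre : Prop :=
  Literature.Barriers.ValiantsHypothesis.FeketeNoSparseSplitWithoutLegendre

@[deprecated Literature.Barriers.ValiantsHypothesis.ω (since := "2026-08-16")]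
alias ω := Literature.Barriers.ValiantsHypothesis.ω

@[deprecated Literature.Barriers.ValiantsHypothesis.norm_omega (since := "2026-08-16")]
alias norm_omega := Literature.Barriers.ValiantsHypothesis.norm_omega

@[deprecated Literature.Barriers.ValiantsHypothesis.norm_one_add_omega (since := "2026-08-16")]
alias norm_one_add_omega := Literature.Barriers.ValiantsHypothesis.norm_one_add_omega

@[deprecated Literature.Barriers.ValiantsHypothesis.ones (since := "2026-08-16")]
alias ones := Literature.Barriers.ValiantsHypothesis.ones

@[deprecated Literature.Barriers.ValiantsHypothesis.comb (since := "2026-08-16")]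
alias comb := Literature.Barriers.ValiantsHypothesis.comb

@[deprecated Literature.Barriers.ValiantsHypothesis.coeff_ones (since := "2026-08-16")]
alias coeff_ones := Literature.Barriers.ValiantsHypothesis.coeff_ones

@[deprecated Literature.Barriers.ValiantsHypothesis.ones_add (since := "2026-08-16")]
alias ones_add := Literature.Barriers.ValiantsHypothesis.ones_add

@[deprecated Literature.Barriers.ValiantsHypothesis.ones_mul_comb (since := "2026-08-16")]
alias ones_mul_comb := Literature.Barriers.ValiantsHypothesis.ones_mul_comb

@[deprecated Literature.Barriers.ValiantsHypothesis.card_support_add_le (since := "2026-08-16")]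
alias card_support_add_le := Literature.Barriers.ValiantsHypothesis.card_support_add_le

@[deprecated Literature.Barriers.ValiantsHypothesis.card_support_sum_le_of_card_le_one
  (since := "2026-08-16")]
alias card_support_sum_le :=
  Literature.Barriers.ValiantsHypothesis.card_support_sum_le_of_card_le_one

@[deprecated Literature.Barriers.ValiantsHypothesis.card_support_ones_le (since := "2026-08-16")]
alias card_support_ones_le := Literature.Barriers.ValiantsHypothesis.card_support_ones_le

@[deprecated Literature.Barriers.ValiantsHypothesis.card_support_comb_le (since := "2026-08-16")]
alias card_support_comb_le := Literature.Barriers.ValiantsHypothesis.card_support_comb_le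

@[deprecated Literature.Barriers.ValiantsHypothesis.natDegree_ones_le (since := "2026-08-16")]
alias natDegree_ones_le := Literature.Barriers.ValiantsHypothesis.natDegree_ones_le

@[deprecated Literature.Barriers.ValiantsHypothesis.Qpoly (since := "2026-08-16")]
alias Qpoly := Literature.Barriers.ValiantsHypothesis.Qpoly

@[deprecated Literature.Barriers.ValiantsHypothesis.Qpoly_eq (since := "2026-08-16")]
alias Qpoly_eq := Literature.Barriers.ValiantsHypothesis.Qpoly_eq

@[deprecated Literature.Barriers.ValiantsHypothesis.coeff_Qpoly (since := "2026-08-16")]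
alias coeff_Qpoly := Literature.Barriers.ValiantsHypothesis.coeff_Qpoly

@[deprecated Literature.Barriers.ValiantsHypothesis.norm_coeff_Qpoly (since := "2026-08-16")]
alias norm_coeff_Qpoly := Literature.Barriers.ValiantsHypothesis.norm_coeff_Qpoly

@[deprecated Literature.Barriers.ValiantsHypothesis.natDegree_Qpoly_lt (since := "2026-08-16")]
alias natDegree_Qpoly_lt := Literature.Barriers.ValiantsHypothesis.natDegree_Qpoly_lt

@[deprecated Literature.Barriers.ValiantsHypothesis.not_feketeNoSparseSplitWithoutLegendre
  (since := "2026-08-16")]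
alias not_feketeNoSparseSplitWithoutLegendre :=
  Literature.Barriers.ValiantsHypothesis.not_feketeNoSparseSplitWithoutLegendre

@[deprecated Literature.Barriers.ValiantsHypothesis.coeff_unimodularModel (since := "2026-08-16")]
alias coeff_unimodularModel := Literature.Barriers.ValiantsHypothesis.coeff_unimodularModel

@[deprecated Literature.Barriers.ValiantsHypothesis.sub_one_le_card_support_mul_card_support
  (since := "2026-08-16")]
alias sub_one_le_card_support_mul_card_support :=
  Literature.Barriers.ValiantsHypothesis.sub_one_le_card_support_mul_card_support

@[deprecated Literature.Barriers.ValiantsHypothesis.two_mul_sqrt_le_card_support_add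
  (since := "2026-08-16")]
alias two_mul_sqrt_le_card_support_add :=
  Literature.Barriers.ValiantsHypothesis.two_mul_sqrt_le_card_support_add

@[deprecated Literature.Barriers.ValiantsHypothesis.feketeNoSparseSplitWithoutLegendre_delta_zero
  (since := "2026-08-16")]
alias feketeNoSparseSplitWithoutLegendre_delta_zero :=
  Literature.Barriers.ValiantsHypothesis.feketeNoSparseSplitWithoutLegendre_delta_zero

@[deprecated Literature.Barriers.ValiantsHypothesis.feketeNoSparseSplitWithoutLegendre_endpoint
  (since := "2026-08-16")]
alias feketeNoSparseSplitWithoutLegendre_endpoint :=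
  Literature.Barriers.ValiantsHypothesis.feketeNoSparseSplitWithoutLegendre_endpoint

end Literature.Uncategorized
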